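import Mathlib
import HarnessLib
import HarnessLib.Audit
import Summits.AtomisticToContinuum.Statement
import Literature.MathematicalPhysics.StatisticalMechanics.LennardJonesClusters
import Summits.AtomisticToContinuum.Crystallization.Theorems.PricedLinkCensusCrysEnergyUpper
import HarnessLib.Audit.Status.Attr

/-!
Route: FlatToriSuffice

# Route FlatToriSuffice — Flat tori suffice — one uniform defect-gap inequality over all periodic
competitors gives both conjuncts

It suffices to show the UNIFORM TORUS DEFECT GAP X (card flat-tori-suffice, its CRUX-T read in the
universal cover): there is a
periodic configuration P₀ of ℝ³ such that for every window radius R and tolerance ε there is g > 0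
with, for EVERY periodic
configuration P — i.e. every finite point set on every flat 3-torus ℝ³/Λ (motif = the point set,
per-cell energy = #motif·e(P)) —
g·#{motif points of P whose radius-R environment in P.points is not ε-matched both ways, after a
linear isometry, to the environment
of some motif site of P₀} ≤ #motif·(e(P) − e(P₀)). X follows from the two ranked cruxes
DefectGapAtMinimiser (rank 2) and
CrysPeriodicMinAttained (rank 4) by pure logic; TwoShellDefectGap (rank 3) is its R = 2 certificate
form. X ⇒ conjunct (i) by
padding-periodisation (cross terms of V_LJ beyond distance 1 are ≤ 0) and trial blocks; X ⇒ conjunct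
(ii) because the same padding
turns every N-particle ground state into a torus point set with ≤ (E(N) − N e(P₀))/g = o(N) bad
particles, so for every (R, ε)
eventually one particle carries a matched window, and windows crystallize (refuter-checked item
3507). No cluster geometry, no
surfaces, no measures; every arrow except X is soft, typed, and rests on PROVED cone facts.
Lean: `∃ P₀ : Literature.MathematicalPhysics.StatisticalMechanics.PeriodicConfiguration 3, ∀ R ε :
ℝ, 0 < R → 0 < ε → ∃ g : ℝ, 0 < g ∧ ∀ P :
Literature.MathematicalPhysics.StatisticalMechanics.PeriodicConfiguration 3, g * ({x :
EuclideanSpace ℝ (Fin 3) | x ∈ P.motif ∧ ¬ (∃ p₀ ∈ P₀.motif, ∃ A : EuclideanSpace ℝ (Fin 3) ≃ₗᵢ[ℝ]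
EuclideanSpace ℝ (Fin 3), (∀ p ∈ P₀.points, dist p p₀ ≤ R → ∃ y ∈ P.points, dist y (x + A (p - p₀))
≤ ε) ∧ (∀ y ∈ P.points, dist y x ≤ R → ∃ p ∈ P₀.points, dist y (x + A (p - p₀)) ≤ ε))}.ncard : ℝ) ≤
(P.motif.card : ℝ) * (P.energyPerParticle
Literature.MathematicalPhysics.StatisticalMechanics.lennardJones - P₀.energyPerParticle
Literature.MathematicalPhysics.StatisticalMechanics.lennardJones)`

## Assembly
The deciding theorem is pure logic plus ONE proved cone fact (Sketch.lean `closes`, sorry-free,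
conclusion `_root_.Crystallization`):
`theorem closes (h0 : TorusDefectGap) (h2 : DefectGapAtMinimiser) (h3 : TwoShellDefectGap) (h4 :
CrysPeriodicMinAttained) (hP :
PeriodisationWithWindows) (hU : CrysEnergyUpper) (hGE : GapGivesEnergy) (hGW : GapGivesWindows) (hWX
: WindowsCrystallize) :
_root_.Crystallization := ⟨hGE h0 hP hU, fun x hx => (P₀ from hGW h0 hP hU; δ from
LennardJonesMinimalDistance_holds; hWX P₀ x ⟨δ,…⟩ …)⟩`.
h0 itself is `target_of_cruxes h2 h4` (obtain P₀ from h4, g from h2 P₀), and h3 is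
`twoShell_of_allScales h2`, so the spine is
ranks 2 ∧ 4 and every listed item is either on the proof path or implied by it (no rung makes the
deciding theorem harder to fire).
The Assembly item below records the spine as one provable-now implication (Sketch.lean
`Assembly_provable`); `closes` does not
depend on it vacuously — it repeats the same five-line argument from h0.

Rationale: WHY THIS LINE. Every energy-localisation line prices the energy POINTWISE on clusters and then
fights boundary and frustration terms; this line
moves the whole problem onto closed flat manifolds, where transfer/gauge terms telescope to zero
identically (HolsztynskiSlawny1978,
Hales2012), and asks for ONE averaged inequality with a defect-count gap, from which both conjuncts
follow by short glue resting
only on proved cone facts (LennardJonesMinimalDistance_holds, BlancLewin2015_8_holds,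
summable_lennardJones_dist_three,
PeriodicConfiguration.tendsto_sum_of_eventually_near', isometryImage/translate). The two signs doing
the work are V_LJ ≤ 0 beyond
r = 1 — padding is free, the T = 0 case of temperedness (Ruelle1969 §3.3–3.4; BlancLewin2015
arXiv:1504.01153 §1.3 (8)–(9)), here
upgraded from energies to DEFECT COUNTS — and "a torus has no boundary". Imported: the
periodic-orbit / ergodic-optimisation viewpoint
(Radin1987: periodic measures are dense, nothing is lost on tori), the 2-D defect-counting format of
HeitmannRadin1980 / De Luca–Friesecke
(arXiv:1605.00034) transplanted to d = 3 as a HYPOTHESIS to be certified rather than a theorem of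
discrete Gauss–Bonnet, and Delone local
theory for the foreseen split (DolbilinLagariasSenechal1998). Versus the retired gen-1 file
(FlatTorusDefectGap, not-a-thesis on
form) this route decides `_root_.Crystallization` by a sorry-free `closes`, drops the stacking rung
(owned by LuttingerTiszaRegistry /
PoissonBesselStacking) and the bridge to the retired cluster form 3505, and keeps only items implied
by the spine 2 ∧ 4.

RANKED CRUXES. #0 TorusDefectGap (target) — X above: ∃ P₀ ∀ R ε > 0 ∃ g > 0 ∀ periodic P,
g·#bad_(R,ε)(P; P₀) ≤ #motif·(e(P) − e(P₀)), where x ∈ P.motif is good iff ∃ motif site p₀ of P₀ and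
a linear isometry A (as ≃ₗᵢ) with every p ∈ P₀.points ∩ B̄(p₀,R) having a point of P within ε of x +
A(p − p₀) and every y ∈ P.points ∩ B̄(x,R) lying within ε of some x + A(p − p₀), p ∈ P₀.points (the
matching clauses of item 3507 verbatim, with P.points for the particles). Implied by ranks 2 ∧ 4
(Sketch.lean `target_of_cruxes`); implies rank 4 (g·#bad ≥ 0 makes P₀ a least element). (why it
might fail: no single P₀ works if two periodic minimisers are not locally isometric at some scale
(polytype tie at the 1e−5 level), or a visible defect family has cost per defect → 0 (vanishing
stacking-fault energy), or the minimum is not attained (rank 4).) [BlancLewin2015, arXiv:1504.01153,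
Ruelle1969, arXiv:1605.00034, CoulangeonSchurmann2021]
#2 DefectGapAtMinimiser (crux) — GAP AT EVERY MINIMISER (card item T1 in its strongest clean form):
every periodic configuration P₀ attaining the minimum of the Lennard-Jones energy per particle
satisfies the all-scales uniform defect-gap inequality of the Target (∀ R ε ∃ g ∀ periodic P).
Content: local uniqueness of the periodic minimiser at every finite resolution, and a strictly
positive price, uniform over ALL periodic competitors of any density and cell size, per
(R,ε)-visible defect at chemical potential e(P₀) — vacancies/interstitials O(1), elastic strain
~(ε/R)², stacking faults ~|J₂|h/R, grain boundaries, amorphous or quasi-periodic approximants,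
cluster surfaces (via padding). Linear-in-count is the natural scaling (each visible defect has a
minimum amplitude, hence a minimum cost, and spoils ≤ CρR³ environments); the hard content is the
GLOBAL part: no non-hcp-like periodic family has energy density approaching e(P₀). [difficulty:
open-problem] (why it might fail: dies if two non-isometric periodic minimisers exist (e(hcp) =
e(polytype) exactly; margin ~1e−5·|e|), if the stacking-fault energy vanishes (Hägg domination
false; J₂ ≈ −7e−5 uncertified), or if an amorphous/modulated periodic family has e → e(P₀) with a
positive bad fraction.) [BlancLewin2015, Stillinger2001, PartayOrtnerCsanyi2017, LoachAckland2017,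
FlatleyTheil2015, CoulangeonSchurmann2021, doi:10.1007/s00023-021-01045-0]
#3 TwoShellDefectGap (crux) — TWO-SHELL CERTIFICATE FORM (the card's CRUX-T with its range FIXED at
R = 2, so that a tiny R cannot trivialise it): for every periodic minimiser P₀ and every ε > 0 there
is g > 0 with g·#bad_(2,ε)(P; P₀) ≤ #motif·(e(P) − e(P₀)) for all periodic P. R = 2 > 2a* ≈ 1.94
sees the shells at a·(1, √2, √(8/3), √3, √(11/3), 2), so h- and c-type sites are already
distinguished (ShortRangeStackingBlindness: fcc/hcp differ first at √(8/3)a). Implied by rank 2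
(instance R = 2, Sketch.lean `twoShell_of_allScales`); conversely rank 2 ⇐ this + robust local rules
for P₀ + counting (two-layer plan (a)). This is exactly what a finite-range transfer certificate /
LP gauge proves by summing local deficits over the torus, where transfers cancel with NO boundary
term — the statement certified computations (arXiv:2506.22614-style) can attack cell by cell.
[difficulty: open-problem] (why it might fail: false iff rank 2 fails at scale 2: a second minimiser
differing within radius 2 (fcc/dhcp-type tie; e_fcc − e_hcp ≈ 7e−5 uncertified) or a (2,ε)-visible
defect family with cost per defect → 0; and R = 2 may be too short for any per-site certificate
(tetrahedra, D5h shells win locally).) [Hales2012, HeitmannRadin1980, Theil2006, FlatleyTheil2015,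
arXiv:2506.22614, Literature.Barriers.AtomisticToContinuum.TetrahedralFrustration,
Literature.Barriers.AtomisticToContinuum.ShortRangeStackingBlindness,
Literature.Barriers.AtomisticToContinuum.DecahedralSoftShell]
#4 CrysPeriodicMinAttained (crux) — the infimum over periodic configurations of ℝ³ (any full-rank
lattice, any finite non-empty motif) of the Lennard-Jones energy per particle is attained — shared
item stmt-AtomisticToContinuum-0627 (same signature; also implied by HcpPeriodicMinimiser 3061 of
LuttingerTiszaRegistry / PoissonBesselStacking / SymmetryRankLadder). In this route it supplies the
reference configuration P₀ (Target ⇐ rank 2 ∧ this) and is the first place an aperiodic optimal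
stacking would bite; it is the one UNPROVED existence statement the mechanism needs, filed
explicitly as a crux. [difficulty: XL] (why it might fail: nothing attains inf e if optimal LJ
stackings are aperiodic with unattained infimum (Hägg domination failing at the 1e−4 margin, cf.
retired RefuteCrystalPeriodicMin), or if per-polytype relaxation of (a, c/a) reorders energies
without a minimum; print treats Bravais lattices only (hcp is not).) [BlancLewin2015,
PartayOrtnerCsanyi2017, LoachAckland2017, BeterminSamajTravenec2022,
Literature.Barriers.AtomisticToContinuum.HcpNotBravais,
Literature.Barriers.AtomisticToContinuum.KissingTwelveDegeneracy]
#9 PeriodisationWithWindows (support) — PADDING-PERIODISATION WITH WINDOWS (transfer (P) of the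
card; pointwise form of 0715): every injective N-point configuration x (N ≥ 1) and radius R admit a
periodic configuration P with motif = range x, N·e(P) ≤ 𝓔_N(x), and P.points ∩ B̄(x_i, R) ⊆ range x
for all i. Proof: lattice L·ℤ³ (ZSpan of a scaled standard basis) with L > diam x + R + 1; distinct
copies are ≥ R + 1 > 1 apart, where V_LJ ≤ 0 (lennardJones_nonpos); the lattice sums are absolutely
summable (summable_lennardJones_dist_three / hasSum), so N·e(P) = 𝓔_N(x) + ½·(cross terms ≤ 0);
points of other copies are > R from every x_i. [difficulty: provable-now] [BlancLewin2015,
Ruelle1969,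
Literature.MathematicalPhysics.StatisticalMechanics.PeriodicConfiguration.summable_lennardJones_dist_three]
#9 CrysEnergyUpper (support) — limsup E(N)/N ≤ ⨅ over periodic configurations of e — shared item
stmt-AtomisticToContinuum-0629 (same signature): finite blocks of any periodic Q plus far-away spare
particles as trial states (boundary o(N) by the r⁻⁶ tail; if the range of e is not bounded below the
⨅ is the junk value 0 and the claim still holds since E(N) ≤ 0). With the Target's P₀ it yields
E(N)/N → e(P₀). [difficulty: M] [BlancLewin2015, Theil2006]
#9 GapGivesEnergy (support) — Target → PeriodisationWithWindows → CrysEnergyUpper →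
HasPeriodicGroundStateEnergy lennardJones 3 (conjunct (i)). Proof: the Target's P₀ is a least
element (g·#bad ≥ 0); e(P₀) ≤ E(N)/N for N ≥ 1 by periodising each injective configuration (le_ciInf
over the injective subtype, nonempty_injective_config); limsup ≤ ⨅ ≤ e(P₀) (ciInf_le, range bounded
below by e(P₀)); BlancLewin2015_8_holds supplies the limit e_∞ with e_∞ = lim ≥ e(P₀) ≥ limsup =
e_∞, hence Tendsto to e(P₀). [deps: TorusDefectGap, PeriodisationWithWindows, CrysEnergyUpper]
[difficulty: provable-now] [BlancLewin2015,
Literature.MathematicalPhysics.StatisticalMechanics.BlancLewin2015_8_holds]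
#9 GapGivesWindows (support) — Target → PeriodisationWithWindows → CrysEnergyUpper → WINDOWS, where
WINDOWS (inlined) = ∃ periodic P₀ such that for every sequence of LJ ground states and all R, ε > 0,
EVENTUALLY IN N some particle i carries a radius-R window ε-matched both ways to x_i + A(P₀.points −
p₀) (p₀ ∈ P₀.motif, A a linear isometry) — literally the second hypothesis of WindowsCrystallize.
Proof: periodise x^N at radius R + ε (so P_N.points ∩ B̄(x_i, R + ε) = particles, and particle i is
good iff the motif point x_i of P_N is good); the Target at (R, ε) gives g·#bad_N ≤ N e(P_N) − N
e(P₀) ≤ E(N) − N e(P₀), and E(N)/N − e(P₀) → 0 (e(P₀) ≤ E(N)/N as in GapGivesEnergy, limsup ≤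
e(P₀)), so #bad_N ≤ N/2 < N eventually and a good particle exists. [deps: TorusDefectGap,
PeriodisationWithWindows, CrysEnergyUpper] [difficulty: provable-now] [BlancLewin2015,
Literature.MathematicalPhysics.StatisticalMechanics.BlancLewin2015_8_holds]
#9 WindowsCrystallize (support) — shared item stmt-AtomisticToContinuum-3507 (same signature;
refuter-checked rc0/plausible 2026-08-15): a uniformly δ-separated sequence of configurations that
eventually carries, for every (R, ε), one ε-matched radius-R window of a fixed periodic P satisfies
the convergence clause of IsCrystallizing (diagonal (j, 1/j), τ_j = −x_(i_j), constant p₀ and A_j →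
A in O(3) along a subsequence, isometryImage/translate,
PeriodicConfiguration.tendsto_sum_of_eventually_near', m ≡ 1). Separation is ASSUMED (the lesson of
negatives 3506); for LJ ground states it is the proved LennardJonesMinimalDistance_holds, supplied
inside `closes`. [difficulty: provable-now] [BlancLewin2015,
Literature.MathematicalPhysics.StatisticalMechanics.PeriodicConfiguration.tendsto_sum_of_eventually_near']

TWO-LAYER PLAN. Foreseen splits (nothing filed now). (a) DefectGapAtMinimiser ⇐ TwoShellDefectGap →
RobustLocalRules → DefectGapAtMinimiser, where
RobustLocalRules(P₀): ∀ R' ε' ∃ ε L: if every point of P.points ∩ B̄(x, L) is (2, ε)-good w.r.t. P₀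
then x is (R', ε')-good (exact version
= local criterion for regular/multiregular systems, DolbilinLagariasSenechal1998, cards
local-theorem-vertex-homogeneity /
multiregular-bounded-counting / barlow-family-exact-propagation; robust version by compactness),
with the counting glue #bad(R',ε') ≤
C(L)·#bad(2,ε) + (energy-priced crowding). (b) TwoShellDefectGap ⇐ CoarseGap → FineStackingGap →
TwoShellDefectGap: a coarse certificate
pricing every two-shell environment far from ALL close-packed ones (frustration regime; cards
frustration-range-lp-hierarchy,
two-shell-rigidity-certificate, signed-frustration-alexandrov-rigidity) and a fine one among
near-Barlow environments (fault-counted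
selection with the true couplings: LuttingerTiszaRegistry's LjFaultCountedSelection 4337 /
PoissonBesselStacking). (c)
CrysPeriodicMinAttained ⇐ HcpPeriodicMinimiser (3061, shared by three open routes) — one line.

KILL CRITERIA. Refutation of CrysPeriodicMinAttained (0627) kills the Target and closes this route
(refuted:CrysPeriodicMinAttained) — together with
conjunct (i) as formalised. An explicit second periodic minimiser not locally isometric to the
first, or a gapless visible-defect family,
refutes DefectGapAtMinimiser (and, if it lives within radius 2, TwoShellDefectGap): restate the
Target for a finite LIST of reference
configurations (the card's CRUX-T(𝓔)) by a new item, or close refuted:DefectGapAtMinimiser if the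
family is amorphous (then the
conjecture itself is in doubt). TwoShellDefectGap cannot die while rank 2 stands (it is an
instance). The four support items are
provable-now: a refutation there is a misstatement to repair, not a kill (3507 already passed a
refuter check; separation is assumed).
A proof elsewhere of HcpPeriodicMinimiser (3061) closes rank 4; a proof of BulkDefectVanish (0751)
does NOT moot this route (different
hypothesis shape) but its window glue 0752 and ours then race to conjunct (ii).

NOT DECOMPOSED YET. The certificate for rank 3 (localisation: Voronoi / transfer / LP gauge; range;
averaging radius), robust local rules and the counting
glue of split (a), the frustration/stacking regime split (b), the constants g(R, ε) ~ min(c ε²/R²,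
|J₂| h/R, −e(P₀)/(c R³)), the
finite-list fallback of the Target, the converse bridge "cluster coercivity (retired 3505) ⇒ Target"
by block limits, the optional
equivalence "gap on all tori ⇔ approximate gauges" ((D) + Hahn–Banach of the card), and the card's
evidence ladder T5 (certified
TwoShellDefectGap with hcp as reference for all tori with ≤ 4, then ≤ 8 points per cell, reading off
g(ε)) — all layer 2.

CHEAPEST FALSIFIER. (1) Certified interval comparison of the relaxed energies e(fcc), e(hcp),
e(dhcp) (each minimised over a and c/a, r⁻⁶ tail bounds; kit,
minutes): a TIE at the certified level kills ranks 2–3 as stated (restate with a finite reference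
list); the expected gaps are e_fcc −
e_hcp ≈ 7·10⁻⁵ and e_dhcp − e_hcp ≈ 3.5·10⁻⁵ in tree units, far above double precision, and two
refuter computations in the hub
(closing note of RefuteCrystalPeriodicMin, 2026-08-15) already report J₂ < 0 dominating. (2) For
rank 2: a search over periodic
competitors with ≤ 4-point motifs for e(P) − e(hcp) < 10⁻⁶ with P not (2, 0.05)-good everywhere
(near-degeneracy witness). (3) The
glue has no falsifier beyond `lean check` (Sketch.lean rc 0). Not run here beyond (3): one-shot
planner session, lit/kit services
intermittently unavailable (searchd rc 75, arXiv/OpenAlex 429 at 18:55Z).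

NUMBERS. Tree normalisation V = r⁻¹²/12 − r⁻⁶/6: with lattice sums A₆(fcc) = 14.45392, A₁₂(fcc) =
12.13188, A₆(hcp) = 14.45489, A₁₂(hcp) =
12.13229 (Stillinger2001), e(a) = (A₁₂ a⁻¹²)/24 − (A₆ a⁻⁶)/12 is minimised at a* = (A₁₂/A₆)^(1/6) ≈
0.9713 with e* = −A₆²/(24 A₁₂) ≈
−0.7176; e_fcc − e_hcp ≈ 7.1·10⁻⁵ (relative 1.0·10⁻⁴); J₂ ≈ −7.3·10⁻⁵, |J₂|/Σ_(k≥3) k|J_k| ≈ 250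
(route-internal, uncertified). R = 2
> 2a* ≈ 1.943 covers the hcp shells 12+6+2+18+12+6 = 56. Minimal distance of LJ ground states: δ > 0
proved qualitatively
(LennardJonesMinimalDistance_holds). E(N) − N e(P₀) = O(N^(2/3)) expected (trial blocks) but only
o(N) is used. Items at open: 10
(1 target, 3 cruxes, 5 support, 1 assembly); `closes` uses h0, hP, hU, hGE, hGW, hWX and one proved
fact.

DEFINITION REQUESTS. None required: the (R, ε)-matching predicate is inlined in every signature with
the clause text of 3507 (a Literature definition
`PeriodicConfiguration.WindowMatched` would shorten the file; optional, not filed). Cite facts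
possibly wanted later by provers of the
two-layer children: certified LJ layer couplings J_k (item 0670 of the stacking routes).

Novelty: Searches (2026-08-15, 18:40–19:00Z): `lit galaxy search "crystallization conjecture" --star all` (10
rows: arXiv:2503.22680 Tisdell–Choksi–Lu,
defects of optimal CVT quantizers on the hexagonal TORUS; Alicandro–Braides–Cicalese 2023
(panama:492168892383261); arXiv:2004.06820;
arXiv:1611.07820); `… "ground states on the torus" --star all` (12 rows, all quantum topological
order — irrelevant); `… "Lennard-Jones periodic
minimizer"` and `… "defect energy per site lower bound"` (0 each); `lit search --source crossref
"crystallization defects energy minimizers lower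
bound number of defects sticky disc"` (14; relevant: doi:10.1007/s00023-021-01045-0 Bétermin 2021,
periodic arrays of defects vs lattice energy
minimisers); `lit search --source zbmath "crystallization Lennard-Jones" --year-from 2010` (11:
doi:10.1007/s00332-017-9401-6 = arXiv:1605.00034
De Luca–Friesecke; arXiv:2506.22614 Ayala–Choksi–Wirth computer-assisted crystallization proofs;
arXiv:2407.20762; doi:10.1016/j.na.2022.113046);
`lit search --source zbmath "De Luca Friesecke crystallization … defects"` (1); `lit search --hybrid
--source local "number of defects energy
minimizers …"` (12 textbooks, none relevant); searchd hybrid rc 75, arXiv API and OpenAlex 429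
(logged); plus the gen-1 runs (`lit frontier
AtomisticToContinuum --since 2020`, 30 rows; `lit bridges --cross any`, 0 relevant; crossref
"multiregular point systems"; zbMATH "energy
minimization periodic sets": doi:10.1093/imrn/rnr048, arXiv:1802.02072) and t  [refs: 10.1007/s00023-021-01045-0, 10.1007/s00332-017-9401-6, 10.1016/j.na.2022.113046, 10.1093/imrn/rnr048, 2503.22680, 2004.06820, 1611.07820, 1605.00034, 2506.22614, 2407.20762, 1802.02072, doi:10.1007/s00023-021-01045-0, doi:10.1007/s00332-017-9401-6, doi:10.1016/j.na.2022.113046, doi:10.1093/imrn/rnr048, Ruelle1969, BlancLewin2015, HolsztynskiSlawny1978, Radin1987]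

Barriers (technique_class: flat-torus-reduction, padding-periodisation, defect-gap): - technique_class: flat-torus-reduction, padding-periodisation, defect-gap
- Literature.Barriers.AtomisticToContinuum.IcosahedralClusters: evaded — finite clusters enter only
through PeriodisationWithWindows with the free sign; icosahedral cores of small ground states are
among the o(N) bad particles; nothing is claimed at finite N.
- Literature.Barriers.AtomisticToContinuum.StickySphereClusters: evaded likewise — no finite-N
exactness, no contact counting.
- Literature.Barriers.AtomisticToContinuum.TetrahedralFrustration: applies to PROVING ranks 2–3 (a
per-site one-shell inequality is false: tetrahedra beat octahedra locally); the cruxes are AVERAGED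
inequalities over a closed flat manifold at range ≥ 2 shells, transfers allowed; the bet is that
torus averaging absorbs frustration — unproved.
- Literature.Barriers.AtomisticToContinuum.DecahedralSoftShell: applies to any future certificate
for rank 3 that reads shells one at a time at 1 % tolerance (negatives 4146); goodness here is a
two-way match of the whole radius-2 environment (≥ 6 shells) to a SITE environment of the minimiser,
and it is priced on average, never inferred from soft kissing.
- Literature.Barriers.AtomisticToContinuum.KissingTwelveDegeneracy: applies — a contact-only gap is
false (every Barlow stacking is kissing-twelve); the cruxes keep the full untruncated tail, whose
|J₂|-scale pays for stacking defects.
- Literature.Barriers.AtomisticToContinuum.ShortRangeStackingBlindness: applies — any surrogate of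

History (route lifecycle, newest last):
- 2026-08-16T03:45:22Z · AUTO-CRUX (backfill): TorusDefectGap — hypotheses of the deciding theorem that nothing in the route derives are cruxes (operator:999:586464)
- 2026-08-24T05:14:23Z · DORMANT — reconciler: no traction for 6.6 d (last activity statement-attached at 2026-08-17T15:13:09Z); parked, not closed — `ledger route dormant route-AtomisticToContin (operator:999:3218699)
- 2026-08-31T09:27:27Z · REACTIVATED (open) — reconciler: reactivated — activity statement-checked at 2026-08-31T08:36:26Z after parking at 2026-08-24T05:14:23Z (operator:999:2597575)

sub-problem: Crystallization · status: open · opened planner-plancard-AtomisticToContinuum-Crystal-05106ae8-g2-0 2026-08-15T18:46:49Z · rev 4 · ledger route-AtomisticToContinuum-FlatToriSuffice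
GENERATED by the gate from the ledger (D-0016/17). Provers cite these decls: `theorem foo : Summit.AtomisticToContinuum.Crystallization.Theses.FlatToriSuffice.<Decl> := …` in Summits/AtomisticToContinuum/Crystallization/Theorems/<Name>.lean.
-/

namespace Summit.AtomisticToContinuum.Crystallization.Theses.FlatToriSuffice

open scoped BigOperators Topology Manifold Classical MeasureTheory ProbabilityTheory Matrix InnerProductSpace ComplexConjugate ContinuousMap
open Filter Set Function TopologicalSpace MeasureTheory

attribute [summit_statement] _root_.Crystallization

/-- item stmt-AtomisticToContinuum-11950 · crux (kind.auto-crux: conjecture-grade) · rank 0 · open · by planner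
why it might fail: no single P₀ works if two periodic minimisers are not locally isometric at some scale (polytype tie at the 1e−5 level), or a visible defect family has cost per defect → 0 (vanishing stacking-fault energy), or the minimum is not attained (rank 4).
sources: BlancLewin2015, arXiv:1504.01153, Ruelle1969, arXiv:1605.00034, CoulangeonSchurmann2021
[target] X above: ∃ P₀ ∀ R ε > 0 ∃ g > 0 ∀ periodic P, g·#bad_(R,ε)(P; P₀) ≤ #motif·(e(P) − e(P₀)),
where x ∈ P.motif is good iff ∃ motif site p₀ of P₀ and a linear isometry A (as ≃ₗᵢ) with every p ∈
P₀.points ∩ B̄(p₀,R) having a point of P within ε of x + A(p − p₀) and every y ∈ P.points ∩ B̄(x,R)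
lying within ε of some x + A(p − p₀), p ∈ P₀.points (the matching clauses of item 3507 verbatim,
with P.points for the particles). Implied by ranks 2 ∧ 4 (Sketch.lean `target_of_cruxes`); implies
rank 4 (g·#bad ≥ 0 makes P₀ a least element). -/
@[route_item "route-AtomisticToContinuum-FlatToriSuffice"]
def TorusDefectGap : Prop :=
  ∃ P₀ : Literature.MathematicalPhysics.StatisticalMechanics.PeriodicConfiguration 3, ∀ R ε : ℝ, 0 < R → 0 < ε → ∃ g : ℝ, 0 < g ∧ ∀ P : Literature.MathematicalPhysics.StatisticalMechanics.PeriodicConfiguration 3, g * ({x : EuclideanSpace ℝ (Fin 3) | x ∈ P.motif ∧ ¬ (∃ p₀ ∈ P₀.motif, ∃ A : EuclideanSpace ℝ (Fin 3) ≃ₗᵢ[ℝ] EuclideanSpace ℝ (Fin 3), (∀ p ∈ P₀.points, dist p p₀ ≤ R → ∃ y ∈ P.points, dist y (x + A (p - p₀)) ≤ ε) ∧ (∀ y ∈ P.points, dist y x ≤ R → ∃ p ∈ P₀.points, dist y (x + A (p - p₀)) ≤ ε))}.ncard : ℝ) ≤ (P.motif.card : ℝ) * (P.energyPerParticle Literature.MathematicalPhysics.StatisticalMechanics.lennardJones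 - P₀.energyPerParticle Literature.MathematicalPhysics.StatisticalMechanics.lennardJones)

/-- item stmt-AtomisticToContinuum-11951 · crux · rank 2 · open · by planner
why it might fail: dies if two non-isometric periodic minimisers exist (e(hcp) = e(polytype) exactly; margin ~1e−5·|e|), if the stacking-fault energy vanishes (Hägg domination false; J₂ ≈ −7e−5 uncertified), or if an amorphous/modulated periodic family has e → e(P₀) with a positive bad fraction.
sources: BlancLewin2015, Stillinger2001, PartayOrtnerCsanyi2017, LoachAckland2017, FlatleyTheil2015, CoulangeonSchurmann2021
[crux] GAP AT EVERY MINIMISER (card item T1 in its strongest clean form): every periodic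
configuration P₀ attaining the minimum of the Lennard-Jones energy per particle satisfies the
all-scales uniform defect-gap inequality of the Target (∀ R ε ∃ g ∀ periodic P). Content: local
uniqueness of the periodic minimiser at every finite resolution, and a strictly positive price,
uniform over ALL periodic competitors of any density and cell size, per (R,ε)-visible defect at
chemical potential e(P₀) — vacancies/interstitials O(1), elastic strain ~(ε/R)², stacking faults
~|J₂|h/R, grain boundaries, amorphous or quasi-periodic approximants, cluster surfaces (via
padding). Linear-in-count is the natural scaling (each visible defect has a minimum amplitude, hence
a minimum cost, and spoils ≤ CρR³ environments); the hard content is the GLOBAL part: no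
non-hcp-like periodic family has energy density approaching e(P₀). [difficulty: open-problem] -/
@[route_item "route-AtomisticToContinuum-FlatToriSuffice"]
def DefectGapAtMinimiser : Prop :=
  ∀ P₀ : Literature.MathematicalPhysics.StatisticalMechanics.PeriodicConfiguration 3, IsLeast (Set.range fun Q : Literature.MathematicalPhysics.StatisticalMechanics.PeriodicConfiguration 3 => Q.energyPerParticle Literature.MathematicalPhysics.StatisticalMechanics.lennardJones) (P₀.energyPerParticle Literature.MathematicalPhysics.StatisticalMechanics.lennardJones) → ∀ R ε : ℝ, 0 < R → 0 < ε → ∃ g : ℝ, 0 < g ∧ ∀ P : Literature.MathematicalPhysics.StatisticalMechanics.PeriodicConfiguration 3, g * ({x : EuclideanSpace ℝ (Fin 3) | x ∈ P.motif ∧ ¬ (∃ p₀ ∈ P₀.motif, ∃ A : EuclideanSpace ℝ (Fin 3) ≃ₗᵢ[ℝ] EuclideanSpace ℝ (Fin 3), (∀ p ∈ P₀.points, dist p p₀ ≤ R → ∃ y ∈ P.points, dist y (x + A (p - p₀)) ≤ ε) ∧ (∀ y ∈ P.points, dist y x ≤ R → ∃ p ∈ P₀.points, dist y (x + A (p - p₀))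 ≤ ε))}.ncard : ℝ) ≤ (P.motif.card : ℝ) * (P.energyPerParticle Literature.MathematicalPhysics.StatisticalMechanics.lennardJones - P₀.energyPerParticle Literature.MathematicalPhysics.StatisticalMechanics.lennardJones)

/-- item stmt-AtomisticToContinuum-11952 · crux · rank 3 · open · by planner
why it might fail: false iff rank 2 fails at scale 2: a second minimiser differing within radius 2 (fcc/dhcp-type tie; e_fcc − e_hcp ≈ 7e−5 uncertified) or a (2,ε)-visible defect family with cost per defect → 0; and R = 2 may be too short for any per-site certificate (tetrahedra, D5h shells win locally).
sources: Hales2012, HeitmannRadin1980, Theil2006, FlatleyTheil2015, arXiv:2506.22614, Literature.Barriers.AtomisticToContinuum.TetrahedralFrustration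
[crux] TWO-SHELL CERTIFICATE FORM (the card's CRUX-T with its range FIXED at R = 2, so that a tiny R
cannot trivialise it): for every periodic minimiser P₀ and every ε > 0 there is g > 0 with
g·#bad_(2,ε)(P; P₀) ≤ #motif·(e(P) − e(P₀)) for all periodic P. R = 2 > 2a* ≈ 1.94 sees the shells
at a·(1, √2, √(8/3), √3, √(11/3), 2), so h- and c-type sites are already distinguished
(ShortRangeStackingBlindness: fcc/hcp differ first at √(8/3)a). Implied by rank 2 (instance R = 2,
Sketch.lean `twoShell_of_allScales`); conversely rank 2 ⇐ this + robust local rules for P₀ +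
counting (two-layer plan (a)). This is exactly what a finite-range transfer certificate / LP gauge
proves by summing local deficits over the torus, where transfers cancel with NO boundary term — the
statement certified computations (arXiv:2506.22614-style) can attack cell by cell. [difficulty:
open-problem] -/
@[route_item "route-AtomisticToContinuum-FlatToriSuffice", crux]
def TwoShellDefectGap : Prop :=
  ∀ P₀ : Literature.MathematicalPhysics.StatisticalMechanics.PeriodicConfiguration 3, IsLeast (Set.range fun Q : Literature.MathematicalPhysics.StatisticalMechanics.PeriodicConfiguration 3 => Q.energyPerParticle Literature.MathematicalPhysics.StatisticalMechanics.lennardJones) (P₀.energyPerParticle Literature.MathematicalPhysics.StatisticalMechanics.lennardJones) → ∀ ε : ℝ, 0 < ε → ∃ g : ℝ, 0 < g ∧ ∀ P : Literature.MathematicalPhysics.StatisticalMechanics.PeriodicConfiguration 3, g * ({x : EuclideanSpace ℝ (Fin 3) | x ∈ P.motif ∧ ¬ (∃ p₀ ∈ P₀.motif, ∃ A : EuclideanSpace ℝ (Fin 3) ≃ₗᵢ[ℝ] EuclideanSpace ℝ (Fin 3), (∀ p ∈ P₀.points, dist p p₀ ≤ (2 : ℝ) → ∃ y ∈ P.points,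 dist y (x + A (p - p₀)) ≤ ε) ∧ (∀ y ∈ P.points, dist y x ≤ (2 : ℝ) → ∃ p ∈ P₀.points, dist y (x + A (p - p₀)) ≤ ε))}.ncard : ℝ) ≤ (P.motif.card : ℝ) * (P.energyPerParticle Literature.MathematicalPhysics.StatisticalMechanics.lennardJones - P₀.energyPerParticle Literature.MathematicalPhysics.StatisticalMechanics.lennardJones)

/-- item stmt-AtomisticToContinuum-0627 · crux · rank 4 · open · by planner
why it might fail: nothing attains inf e if optimal LJ stackings are aperiodic with unattained infimum (Hägg domination failing at the 1e−4 margin, cf. retired RefuteCrystalPeriodicMin), or if per-polytype relaxation of (a, c/a) reorders energies without a minimum; print treats Bravais lattices only (hcp is not).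
sources: BlancLewin2015, PartayOrtnerCsanyi2017, LoachAckland2017, BeterminSamajTravenec2022, Literature.Barriers.AtomisticToContinuum.HcpNotBravais, Literature.Barriers.AtomisticToContinuum.KissingTwelveDegeneracy
The infimum over periodic configurations of ℝ³ of the Lennard-Jones energy per particle is attained
(by some lattice G and finite motif F). Needs stacking selection (c) + compactness of near-optimal
periodic configurations at bounded density / bounded-below distances; refuted if optimal LJ
stackings are aperiodic with unattained infimum (route RefuteCrystalPeriodicMin). -/
@[route_item "route-AtomisticToContinuum-FlatToriSuffice", crux]
def CrysPeriodicMinAttained : Prop :=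
  ∃ P : Literature.MathematicalPhysics.StatisticalMechanics.PeriodicConfiguration 3, IsLeast (Set.range fun Q : Literature.MathematicalPhysics.StatisticalMechanics.PeriodicConfiguration 3 => Q.energyPerParticle Literature.MathematicalPhysics.StatisticalMechanics.lennardJones) (P.energyPerParticle Literature.MathematicalPhysics.StatisticalMechanics.lennardJones)

/-- item stmt-AtomisticToContinuum-17669 · crux · rank 5 · open · by planner
why it might fail: False if a periodic LJ minimiser is not pinned by its radius-2 atlas: a long-period polytype or exotic minimiser with sites 2-locally identical but R-distinct (period > 2), or slowly rotating/strained competitors that stay (2,η)-good for every η yet break the (R,ε)-match; R₀ = 2 is the route's bet.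
sources: DolbilinLagariasSenechal1998, doi:10.1109/isvd.2013.22, doi:10.1007/978-94-015-8784-6_4, Theil2006, Literature.Barriers.AtomisticToContinuum.ShortRangeStackingBlindness, Literature.Barriers.AtomisticToContinuum.FlexibleKissingArrangements
[crux] X_L of the scale split of TorusDefectGap — ROBUST TWO-SHELL LOCAL RULES at every periodic LJ
minimiser P₀ (the route's foreseen 'RobustLocalRules', two-layer plan (a); Delone–Dolbilin local
theory in robust form): for every target window (R, ε) there are a tolerance η > 0 and a radius L >
0 such that in ANY periodic configuration P, a point x all of whose neighbours y ∈ P.points within L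
are (2, η)-good (radius-2 environment η-matched both ways, after a linear isometry, to a motif-site
environment of P₀ — the matching clauses of TwoShellDefectGap verbatim) is itself (R, ε)-good. Pure
geometry of P₀, no energy: local P₀-likeness at the two-shell scale propagates to every scale, η(R,
ε) absorbing elastic/rotational accumulation (~ε/R, ~ε/R²) and L ≥ R guarding against far defects;
η-clusters (multiplicity below the matching tolerance) are invisible at both scales consistently.
Exact version (η = 0, arbitrary point sets) = the local criterion for regular/multiregular systems
specialised to the atlas of radius-2 clusters of P₀ (hcp: shells at a*≈0.971 times 1, √2, √(8/3),
√3, √(11/3), 2, all < 2; the h-type √(8/3)-pair pins the stacking); robust version by compactness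
(Kuratowsk -/
@[route_item "route-AtomisticToContinuum-FlatToriSuffice", crux]
def TwoShellLocalRules : Prop :=
  ∀ P₀ : Literature.MathematicalPhysics.StatisticalMechanics.PeriodicConfiguration 3, IsLeast (Set.range fun Q : Literature.MathematicalPhysics.StatisticalMechanics.PeriodicConfiguration 3 => Q.energyPerParticle Literature.MathematicalPhysics.StatisticalMechanics.lennardJones) (P₀.energyPerParticle Literature.MathematicalPhysics.StatisticalMechanics.lennardJones) → ∀ R ε : ℝ, 0 < R → 0 < ε → ∃ η L : ℝ, 0 < η ∧ 0 < L ∧ ∀ P : Literature.MathematicalPhysics.StatisticalMechanics.PeriodicConfiguration 3, ∀ x ∈ P.points, (∀ y ∈ P.points, dist y x ≤ L → ∃ p₀ ∈ P₀.motif, ∃ A : EuclideanSpace ℝ (Fin 3) ≃ₗᵢ[ℝ] EuclideanSpace ℝ (Fin 3), (∀ p ∈ P₀.points, dist p p₀ ≤ (2 : ℝ) → ∃ y' ∈ P.points, dist y' (y + A (p - p₀)) ≤ η) ∧ (∀ y' ∈ P.points, dist y' y ≤ (2 : ℝ) → ∃ p ∈ P₀.points, dist y' (y + A (p - p₀)) ≤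 η)) → ∃ p₀ ∈ P₀.motif, ∃ A : EuclideanSpace ℝ (Fin 3) ≃ₗᵢ[ℝ] EuclideanSpace ℝ (Fin 3), (∀ p ∈ P₀.points, dist p p₀ ≤ R → ∃ y ∈ P.points, dist y (x + A (p - p₀)) ≤ ε) ∧ (∀ y ∈ P.points, dist y x ≤ R → ∃ p ∈ P₀.points, dist y (x + A (p - p₀)) ≤ ε)

/-- item stmt-AtomisticToContinuum-11865 · support · rank 9 · closed · proved by Summit.AtomisticToContinuum.Crystallization.Theorems.crysEnergyUpper_proof @ e4cec8285cc2 (prover) · by planner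
[support] trial-state upper bound limsup E(N)/N ≤ ⨅ over periodic Q of e_LJ(Q) (shared item 0629,
same signature: finite blocks of Q plus far-away extras, boundary O(N^{2/3}), r⁻⁶ tail summable in d
= 3; le_ciInf needs only Nonempty; coboundedness of the limsup from BlancLewin2015_8_holds /
lennardJones_stable_holds, both proved in tree). [difficulty: provable-now] -/
@[route_item "route-AtomisticToContinuum-FlatToriSuffice", crux]
def CrysEnergyUpper : Prop :=
  Filter.limsup (fun N : ℕ => Literature.MathematicalPhysics.StatisticalMechanics.groundStateEnergy Literature.MathematicalPhysics.StatisticalMechanics.lennardJones 3 N / N) Filter.atTop ≤ ⨅ Q : Literature.MathematicalPhysics.StatisticalMechanics.PeriodicConfiguration 3, Q.energyPerParticle Literature.MathematicalPhysics.StatisticalMechanics.lennardJones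

/-- `CrysEnergyUpper` holds: proved by `Summit.AtomisticToContinuum.Crystallization.Theorems.crysEnergyUpper_proof` @ e4cec8285cc2. -/
theorem CrysEnergyUpper_holds : CrysEnergyUpper := _root_.Summit.AtomisticToContinuum.Crystallization.Theorems.crysEnergyUpper_proof

/-- item stmt-AtomisticToContinuum-11953 · support · rank 9 · open · by planner
sources: BlancLewin2015, Ruelle1969, Literature.MathematicalPhysics.StatisticalMechanics.PeriodicConfiguration.summable_lennardJones_dist_three
[support] PADDING-PERIODISATION WITH WINDOWS (transfer (P) of the card; pointwise form of 0715):
every injective N-point configuration x (N ≥ 1) and radius R admit a periodic configuration P with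
motif = range x, N·e(P) ≤ 𝓔_N(x), and P.points ∩ B̄(x_i, R) ⊆ range x for all i. Proof: lattice L·ℤ³
(ZSpan of a scaled standard basis) with L > diam x + R + 1; distinct copies are ≥ R + 1 > 1 apart,
where V_LJ ≤ 0 (lennardJones_nonpos); the lattice sums are absolutely summable
(summable_lennardJones_dist_three / hasSum), so N·e(P) = 𝓔_N(x) + ½·(cross terms ≤ 0); points of
other copies are > R from every x_i. [difficulty: provable-now] -/
@[route_item "route-AtomisticToContinuum-FlatToriSuffice", crux]
def PeriodisationWithWindows : Prop :=
  ∀ (N : ℕ) (x : Fin N → EuclideanSpace ℝ (Fin 3)), 0 < N → Function.Injective x → ∀ R : ℝ, ∃ P : Literature.MathematicalPhysics.StatisticalMechanics.PeriodicConfiguration 3, (↑P.motif : Set (EuclideanSpace ℝ (Fin 3))) = Set.range x ∧ (N : ℝ) * P.energyPerParticle Literature.MathematicalPhysics.StatisticalMechanics.lennardJones ≤ Literature.MathematicalPhysics.StatisticalMechanics.interactionEnergy Literature.MathematicalPhysics.StatisticalMechanics.lennardJones x ∧ ∀ i : Fin N, ∀ y ∈ P.points, dist y (x i) ≤ R → y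 ∈ Set.range x

/-- item stmt-AtomisticToContinuum-11954 · support · rank 9 · open · by planner
sources: BlancLewin2015, Literature.MathematicalPhysics.StatisticalMechanics.BlancLewin2015_8_holds
[support] Target → PeriodisationWithWindows → CrysEnergyUpper → HasPeriodicGroundStateEnergy
lennardJones 3 (conjunct (i)). Proof: the Target's P₀ is a least element (g·#bad ≥ 0); e(P₀) ≤
E(N)/N for N ≥ 1 by periodising each injective configuration (le_ciInf over the injective subtype,
nonempty_injective_config); limsup ≤ ⨅ ≤ e(P₀) (ciInf_le, range bounded below by e(P₀));
BlancLewin2015_8_holds supplies the limit e_∞ with e_∞ = lim ≥ e(P₀) ≥ limsup = e_∞, hence Tendsto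
to e(P₀). [deps: TorusDefectGap, PeriodisationWithWindows, CrysEnergyUpper] [difficulty:
provable-now] -/
@[route_item "route-AtomisticToContinuum-FlatToriSuffice", crux]
def GapGivesEnergy : Prop :=
  TorusDefectGap → PeriodisationWithWindows → CrysEnergyUpper → Literature.MathematicalPhysics.StatisticalMechanics.HasPeriodicGroundStateEnergy Literature.MathematicalPhysics.StatisticalMechanics.lennardJones 3

/-- item stmt-AtomisticToContinuum-11955 · support · rank 9 · open · by planner
sources: BlancLewin2015, Literature.MathematicalPhysics.StatisticalMechanics.BlancLewin2015_8_holds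
[support] Target → PeriodisationWithWindows → CrysEnergyUpper → WINDOWS, where WINDOWS (inlined) = ∃
periodic P₀ such that for every sequence of LJ ground states and all R, ε > 0, EVENTUALLY IN N some
particle i carries a radius-R window ε-matched both ways to x_i + A(P₀.points − p₀) (p₀ ∈ P₀.motif,
A a linear isometry) — literally the second hypothesis of WindowsCrystallize. Proof: periodise x^N
at radius R + ε (so P_N.points ∩ B̄(x_i, R + ε) = particles, and particle i is good iff the motif
point x_i of P_N is good); the Target at (R, ε) gives g·#bad_N ≤ N e(P_N) − N e(P₀) ≤ E(N) − N
e(P₀), and E(N)/N − e(P₀) → 0 (e(P₀) ≤ E(N)/N as in GapGivesEnergy, limsup ≤ e(P₀)), so #bad_N ≤ N/2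
< N eventually and a good particle exists. [deps: TorusDefectGap, PeriodisationWithWindows,
CrysEnergyUpper] [difficulty: provable-now] -/
@[route_item "route-AtomisticToContinuum-FlatToriSuffice", crux]
def GapGivesWindows : Prop :=
  TorusDefectGap → PeriodisationWithWindows → CrysEnergyUpper → ∃ P₀ : Literature.MathematicalPhysics.StatisticalMechanics.PeriodicConfiguration 3, ∀ x : (N : ℕ) → (Fin N → EuclideanSpace ℝ (Fin 3)), (∀ N, Literature.MathematicalPhysics.StatisticalMechanics.IsGroundState Literature.MathematicalPhysics.StatisticalMechanics.lennardJones (x N)) → ∀ R ε : ℝ, 0 < R → 0 < ε → ∀ᶠ N in Filter.atTop, ∃ i : Fin N, ∃ p₀ ∈ P₀.motif, ∃ A : EuclideanSpace ℝ (Fin 3) ≃ₗᵢ[ℝ] EuclideanSpace ℝ (Fin 3), (∀ p ∈ P₀.points, dist p p₀ ≤ R → ∃ j : Fin N, dist (x N j) (x N i + A (p - p₀)) ≤ ε) ∧ (∀ j : Fin N, dist (x N j) (x N i) ≤ R → ∃ p ∈ P₀.points, dist (x N j) (x N i + A (p - p₀)) ≤ ε)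

/-- item stmt-AtomisticToContinuum-11956 · support · rank 9 · open · by planner
sources: BlancLewin2015, Literature.MathematicalPhysics.StatisticalMechanics.PeriodicConfiguration.tendsto_sum_of_eventually_near'
[support] shared item stmt-AtomisticToContinuum-3507 (same signature; refuter-checked rc0/plausible
2026-08-15): a uniformly δ-separated sequence of configurations that eventually carries, for every
(R, ε), one ε-matched radius-R window of a fixed periodic P satisfies the convergence clause of
IsCrystallizing (diagonal (j, 1/j), τ_j = −x_(i_j), constant p₀ and A_j → A in O(3) along a
subsequence, isometryImage/translate, PeriodicConfiguration.tendsto_sum_of_eventually_near', m ≡ 1).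
Separation is ASSUMED (the lesson of negatives 3506); for LJ ground states it is the proved
LennardJonesMinimalDistance_holds, supplied inside `closes`. [difficulty: provable-now] -/
@[route_item "route-AtomisticToContinuum-FlatToriSuffice", crux]
def WindowsCrystallize : Prop :=
  ∀ (P : Literature.MathematicalPhysics.StatisticalMechanics.PeriodicConfiguration 3) (x : (N : ℕ) → (Fin N → EuclideanSpace ℝ (Fin 3))), (∃ δ : ℝ, 0 < δ ∧ ∀ (N : ℕ) (i j : Fin N), i ≠ j → δ ≤ dist (x N i) (x N j)) → (∀ R ε : ℝ, 0 < R → 0 < ε → ∀ᶠ N in Filter.atTop, ∃ i : Fin N, ∃ p₀ ∈ P.motif, ∃ A : EuclideanSpace ℝ (Fin 3) ≃ₗᵢ[ℝ] EuclideanSpace ℝ (Fin 3), (∀ p ∈ P.points, dist p p₀ ≤ R → ∃ j : Fin N, dist (x N j) (x N i + A (p - p₀)) ≤ ε) ∧ (∀ j : Fin N, dist (x N j) (x N i) ≤ R → ∃ p ∈ P.points, dist (x N j) (x N i + A (p - p₀)) ≤ ε)) → ∃ (φ : ℕ → ℕ) (τ : ℕ → EuclideanSpace ℝ (Fin 3))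 (P' : Literature.MathematicalPhysics.StatisticalMechanics.PeriodicConfiguration 3) (m : EuclideanSpace ℝ (Fin 3) → ℕ), StrictMono φ ∧ (∀ s ∈ P'.points, 1 ≤ m s) ∧ (∀ g ∈ P'.lattice, ∀ s, m (s + g) = m s) ∧ ∀ f : EuclideanSpace ℝ (Fin 3) → ℝ, Continuous f → HasCompactSupport f → Filter.Tendsto (fun j => ∑ i : Fin (φ j), f (x (φ j) i + τ j)) Filter.atTop (nhds (∑' s : P'.points, (m s : ℝ) * f s))

/-- item stmt-AtomisticToContinuum-14103 · support · rank 9 · open · by planner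
[support] GLUE cruxes ⇒ target (route-choice hold 2026-08-16 `route.target-unreachable`, option
(a)): ranks 2 ∧ 4 give the Target — DefectGapAtMinimiser → CrysPeriodicMinAttained → TorusDefectGap.
Proof (pure logic, two lines): obtain ⟨P₀, hP₀⟩ from CrysPeriodicMinAttained (a periodic
configuration whose LJ energy per particle IsLeast over all periodic configurations) and take ⟨P₀,
DefectGapAtMinimiser P₀ hP₀⟩; the quantifier bodies of TorusDefectGap and DefectGapAtMinimiser (∀ R
ε > 0 ∃ g > 0 ∀ periodic P, g·#bad_(R,ε)(P; P₀) ≤ #motif·(e(P) − e(P₀))) are syntactically identical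
once P₀ is fixed. Checked: planner Sketch.lean `targetOfCruxes_provable : TargetOfCruxes` elaborates
sorry-free (lean check rc 0, axioms propext/Classical.choice/Quot.sound, 2026-08-16). This is the
spine arrow the thesis calls `target_of_cruxes h2 h4`; with it the deciding theorem `closes` (which
takes h0 : TorusDefectGap) fires from the ranked cruxes. [deps: DefectGapAtMinimiser,
CrysPeriodicMinAttained] [difficulty: provable-now] [sources: BlancLewin2015 (arXiv:1504.01153)
§2.1; route file FlatToriSuffice.lean rev 2] -/
@[route_item "route-AtomisticToContinuum-FlatToriSuffice"]
def TargetOfCruxes : Prop :=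
  DefectGapAtMinimiser → CrysPeriodicMinAttained → TorusDefectGap

/-- item stmt-AtomisticToContinuum-17670 · support · rank 9 · open · by planner
sources: Ruelle1969, BlancLewin2015, Literature.MathematicalPhysics.StatisticalMechanics.PeriodicConfiguration.summable_lennardJones_dist_three
[support] X_C of the scale split of TorusDefectGap — PRICED CLOSE PAIRS at every periodic minimiser
P₀ (support, provable-now, size L): there are r, c > 0 such that for every periodic P, c·#D_r(P) ≤
#motif·(e(P) − e(P₀)), where D_r(P) = motif points having another point of P within distance < r.
Why needed: the (R,ε)-matching is blind to clusters of diameter ≤ ε (several P-points within ε of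
one image point are all 'good'), so neither TwoShellDefectGap nor the local rules price them; the
counting charges only r-ISOLATED bad points to (2,η)-bad ones (packing), and D_r is priced here.
Proof sketch: delete ALL of D := D_r from the motif (if D ≠ motif): U(P) = U(P∖D) +
Σ_{x∈D}Σ_{y∈(P∖D).points}V + U_D (torus pair-sum symmetry); U(P∖D) ≥ (#motif − #D)·e(P₀) by
minimality; the remaining points are r-isolated, so the cross term is ≥ −#D·C₆(r) (shell counting of
an r-separated set, V ≥ −r⁻⁶/6); every point of D.points has a neighbour within r inside D.points,
so writing V = θρ⁻¹²/12 + W_θ with W_θ(ρ) = (1−θ)⁻¹·V_LJ(ρ/(1−θ)^{1/6}) (a rescaled LJ, hence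
stable: e_{W_θ} ≥ −B_θ on periodic configurations) gives U_D ≥ #D·(θ r⁻¹²/24 − B_θ); altogether
#motif·(e(P) − e(P₀)) ≥ #D·(θr⁻¹²/24 − B_θ − -/
@[route_item "route-AtomisticToContinuum-FlatToriSuffice", crux]
def PricedClosePairs : Prop :=
  ∀ P₀ : Literature.MathematicalPhysics.StatisticalMechanics.PeriodicConfiguration 3, IsLeast (Set.range fun Q : Literature.MathematicalPhysics.StatisticalMechanics.PeriodicConfiguration 3 => Q.energyPerParticle Literature.MathematicalPhysics.StatisticalMechanics.lennardJones) (P₀.energyPerParticle Literature.MathematicalPhysics.StatisticalMechanics.lennardJones) → ∃ r c : ℝ, 0 < r ∧ 0 < c ∧ ∀ P : Literature.MathematicalPhysics.StatisticalMechanics.PeriodicConfiguration 3, c * ({x : EuclideanSpace ℝ (Fin 3) | x ∈ P.motif ∧ ∃ z ∈ P.points, z ≠ x ∧ dist z x < r}.ncard : ℝ) ≤ (P.motif.card : ℝ) * (P.energyPerParticle Literature.MathematicalPhysics.StatisticalMechanics.lennardJones - P₀.energyPerParticle Literature.MathematicalPhysics.StatisticalMechanics.lennardJones)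

/-- item stmt-AtomisticToContinuum-17671 · support · rank 9 · open · by planner
sources: Summits/AtomisticToContinuum/Crystallization/Cruxes/TorusDefectGap/SplitAssembly.lean, DolbilinLagariasSenechal1998, BlancLewin2015
[support] SPLIT GLUE of the scale seam (crux-strategist BC2 redirect of the RESTATED deciding crux,
2026-08-17): X_E ∧ X_T ∧ X_L ∧ X_C ⇒ TorusDefectGap. PROVED sorry-free as theorem
torusDefectGap_of_pieces in
Summits/AtomisticToContinuum/Crystallization/Cruxes/TorusDefectGap/SplitAssembly.lean @a0e6a972dfb9
(lean check rc0, ≈120 tactic lines, axioms propext/Classical.choice/Quot.sound; its route-form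
statement inlines the two new pieces verbatim, so `theorem glue_proof : TorusDefectGapSplitGlue :=
Cruxes…Split.torusDefectGap_of_pieces` modulo the import cycle — a prover lands the attached ready
file Theorems/FlatToriSufficeTorusDefectGapSplit.lean, which repeats the proof against the route
decls). Proof: P₀ from X_E; for (R,ε) take (η,L) from X_L, g₂ from X_T at tolerance η, (r,c) from
X_C, g := (1/c + (2L/r+1)³/g₂)⁻¹; split the (R,ε)-bad motif points of P into D_r (priced by X_C) and
the r-isolated ones; an isolated bad x has by X_L (contrapositive) a (2,η)-bad y ∈ P.points within
L, whose motif representative m is (2,η)-bad too (goodness is invariant under the lattice of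
periods); the fibre of the charging map x ↦ m injects (x ↦ x − y_x + m; motif points are
inequivalent mod the -/
@[route_item "route-AtomisticToContinuum-FlatToriSuffice", crux]
def TorusDefectGapSplitGlue : Prop :=
  CrysPeriodicMinAttained → TwoShellDefectGap → TwoShellLocalRules → PricedClosePairs → TorusDefectGap

/-- item stmt-AtomisticToContinuum-11957 · assembly · rank 1 · open · by planner
sources: BlancLewin2015, Literature.MathematicalPhysics.StatisticalMechanics.LennardJonesMinimalDistance_holds
[assembly] DefectGapAtMinimiser → CrysPeriodicMinAttained → PeriodisationWithWindows →
CrysEnergyUpper → GapGivesEnergy → GapGivesWindows → WindowsCrystallize → Crystallization (LJ, d =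
3; the sub-problem Statement decl `_root_.Crystallization`), by target_of_cruxes + the glue +
LennardJonesMinimalDistance_holds. -/
@[route_item "route-AtomisticToContinuum-FlatToriSuffice"]
def Assembly : Prop :=
  DefectGapAtMinimiser → CrysPeriodicMinAttained → PeriodisationWithWindows → CrysEnergyUpper → GapGivesEnergy → GapGivesWindows → WindowsCrystallize → _root_.Crystallization

/-! D-0027 §2.1 — DECIDING THEOREM (planner-authored via `route open/edit --closes-file`; by planner-cstrat-stmt-AtomisticToContinuum-11950-r1-0 2026-08-17T04:11:38Z):
its hypotheses are this route's items and its conclusion the sub-problem Statement (glue_lint), and it elaborates with this file. -/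

@[closes "route-AtomisticToContinuum-FlatToriSuffice"] theorem closes : CrysPeriodicMinAttained → TwoShellDefectGap → TwoShellLocalRules → PricedClosePairs → TorusDefectGapSplitGlue → PeriodisationWithWindows → CrysEnergyUpper → GapGivesEnergy → GapGivesWindows → WindowsCrystallize → _root_.Crystallization := by
  intro hE hT hL hC hG hP hU hGE hGW hWX
  have h0 : TorusDefectGap := hG hE hT hL hC
  refine ⟨hGE h0 hP hU, fun x hx => ?_⟩
  obtain ⟨P₀, hP₀⟩ := hGW h0 hP hU
  obtain ⟨δ, hδ, hsep⟩ :=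
    Literature.MathematicalPhysics.StatisticalMechanics.LennardJonesMinimalDistance_holds
  exact hWX P₀ x ⟨δ, hδ, fun N i j hij => hsep N (x N) (hx N) i j hij⟩
    (fun R ε hR hε => hP₀ x hx R ε hR hε)

end Summit.AtomisticToContinuum.Crystallization.Theses.FlatToriSuffice
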